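import Summits.BirchSwinnertonDyer.BirchSwinnertonDyer.Theorems.ErratumRoadFiveEulerHalfNotRamRung605a1LocalData
import Summits.BirchSwinnertonDyer.BirchSwinnertonDyer.Theorems.Rank1ResidualIntModelSurjectivity
import Summits.BirchSwinnertonDyer.Rank1Residual.X11b.CertificateCheckBridge
import Summits.BirchSwinnertonDyer.Rank1Residual.Partition.CellOf
import Mathlib.Data.Fintype.Parity
import HarnessLib
/-!
# Route `ErratumRoadFive`, crux `EulerHalfNotRamNoInertSetAtFive` (item stmt-BirchSwinnertonDyer-19715), line `birth` —
# (605a1, 5): THE IMAGE HYPOTHESES IN THE KERNEL — `ρ̄_{E,5}` SURJECTIVE (Serre witnesses 7, 3, 3), `E[5]` irreducible,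
# so the class predicate `ClassX11b E 5` reduces to the analytic rank `r_an(E) = 1` (ROUTE-FREE file)

Cell `bsd-stepL`, seat `bsd-line-er5-p1-w3` (D-0154 extra width seat on crux 19715, lead `bsd-line-er5-p1`), `--supports stmt-BirchSwinnertonDyer-19715`.
THEOREMS ONLY, ONE curve: `E = [1, -1, 0, -1414, -44027]` = Cremona **605a1** (`N = 605 = 5·11²`, `Δ_min = −5⁵·11⁸`). The registered BC5 rung pair of piece S1b (`Statement.stub_rung_res_605a1`: `5` the ONLY multiplicative prime, split, self-carrier — the
exceptional-zero core; lead p615583 §4; -w4's route-free `…Rung605a1LocalData` gives the integral model, `Mult E 5`, `split_five`, `¬ Ram`, the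
binders; this file adds the IMAGE at `5`).
The registered rung's text binds `ClassX11b E 5` (= `r_an = 1 ∧ 5 ≠ 2 ∧ Mult E 5 ∧ Irr E 5`) and `Surj E 5`; here the two IMAGE conjuncts are
CERTIFIED IN THE KERNEL from the integer equation, by the tree's Serre-witness theorem `IntModel.hasSurjectiveModNGaloisRep_of_intModel_of_serreWitnesses`
(Serre 1972 Prop. 19; frame, Frobenius trace and `det = χ̄₅` are tree theorems) fed with kernel point counts (`X11b.natCard_point_eq_countPoints`,
Euler's criterion, `decide +kernel` on the schema's `countPoints`) — the pattern of this seat's `…Rung129360cy1Image.lean`: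

* `#Ẽ(𝔽_7) = 5` (`a_7 = 3`), `#Ẽ(𝔽_3) = 7` (`a_3 = -3`); these primes do not divide `Δ`.
* Serre's three witnesses modulo `5`: (i) `ℓ₁ = 7`: `a² − 4ℓ ≡ 1 = 1²` a non-zero square, `a ≢ 0`; (ii) `ℓ₂ = 3`: `a² − 4ℓ ≡ 2` a non-square,
  `a ≢ 0`; (iii) `ℓ₃ = 3`: `u = a²/ℓ ≡ 3 ∉ {0, 1, 2, 4}`, `u² − 3u + 1 ≢ 0`. Hence **`Surj E 5`** (`surj_five`), **`Irr E 5`** (`irr_five`),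
  **`ClassX11b E 5 ↔ E.analyticRank = 1`** (`classX11b_five_iff_analyticRank`, with `mult_five`).

So the rung's per-pair hypotheses `Surj`, `Irr`, `Mult` are kernel theorems and the ONE per-pair input left is `r_an(E) = 1` (Cremona: `r = 1`,
`galrep`: no exceptional prime — now a kernel statement at `5`).

HONEST FRAMING: route-free Galois-image facts of ONE curve; `r_an(E) = 1` is NOT certified here; a helper `--supports` 19715, not a closure;
BSD(605a1, 5) is NOT proved by this; nothing is booked; no summit statement is touched; no definition, no named fact, no `sorry`, no kit.
`decide +kernel` is used only for the point counts (the schema's integer arithmetic), plain `decide` for arithmetic in `ZMod 5` (stated binder-free: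
with a `[Fact (Nat.Prime 5)]` in scope the `ZMod 5` casts route through `ZMod.instField` and `decide` refuses the free variable).

References: [Serre1972] §2.8 Prop. 19, §5.2 (iii); [Mazur1978] Prop. 6.3 (1); [IrelandRosen1990] Prop. 5.1.2; [Cremona1997] Table 1 ∕ ecdata
(curve 605a1); [SilvermanAEC2009] VII.5 Prop. 5.1.
-/

noncomputable section

open scoped Classical NumberField

open WeierstrassCurve NumberField IsDedekindDomain Literature.NumberTheory.EllipticCurves
  Literature.NumberTheory.EllipticCurves.Rank1Residual
  Literature.NumberTheory.EllipticCurves.Rank1Residual.X11RankOneCertificates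
  Summit.BirchSwinnertonDyer.Rank1Residual Summit.BirchSwinnertonDyer.Rank1Residual.X11b
  Summit.BirchSwinnertonDyer.BirchSwinnertonDyer.Rank1Residual

-- the cell's Theorems namespace repeats the summit name (Summit.<Summit>.<Problem>), as in every sibling file
set_option linter.dupNamespace false

namespace Summit.BirchSwinnertonDyer.BirchSwinnertonDyer.Theorems.EulerHalfSplitTwinRoad.Rung605a1

/-! ### Kernel point counts at the witness primes -/

/-- **`#Ẽ(𝔽_7) = 5`** for the reduction of `E₀ = [1, -1, 0, -1414, -44027]` (`a_7 = 3`): the schema's `countPoints` by Euler's criterion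
(`X11b.natCard_point_eq_countPoints`), evaluated in the kernel. [cite: IrelandRosen1990, Prop. 5.1.2] [cite: Cremona1997, Table 1 (curve 605a1)] -/
theorem natCard_point_seven :
    Nat.card (((⟨1, -1, 0, -1414, -44027⟩ : WeierstrassCurve ℤ).map (Int.castRingHom (ZMod 7))).toAffine.Point) = 5 := by
  have h := X11b.natCard_point_eq_countPoints 1 (-1) 0 (-1414) (-44027) 7 (hℓ := ⟨by norm_num⟩) (by norm_num)
    (by rw [Δ_eq]; norm_num)
  have h' : countPoints [1, -1, 0, -1414, -44027] 7 = 5 := by decide +kernel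
  exact_mod_cast h.trans h'

/-- **`#Ẽ(𝔽_3) = 7`** for the reduction of `E₀ = [1, -1, 0, -1414, -44027]` (`a_3 = -3`): the schema's `countPoints` by Euler's criterion
(`X11b.natCard_point_eq_countPoints`), evaluated in the kernel. [cite: IrelandRosen1990, Prop. 5.1.2] [cite: Cremona1997, Table 1 (curve 605a1)] -/
theorem natCard_point_three :
    Nat.card (((⟨1, -1, 0, -1414, -44027⟩ : WeierstrassCurve ℤ).map (Int.castRingHom (ZMod 3))).toAffine.Point) = 7 := by
  have h := X11b.natCard_point_eq_countPoints 1 (-1) 0 (-1414) (-44027) 3 (hℓ := ⟨by norm_num⟩) (by norm_num)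
    (by rw [Δ_eq]; norm_num)
  have h' : countPoints [1, -1, 0, -1414, -44027] 3 = 7 := by decide +kernel
  exact_mod_cast h.trans h'

/-! ### Serre's three conditions modulo 5 (closed decidable statements) -/

/-- Serre's condition (i) at `ℓ₁ = 7` modulo `5` (`a = 7 + 1 − 5 = 3`): `a² − 4ℓ ≡ 1·1` is a non-zero square and `a ≢ 0`.
[cite: Serre1972, §2.8 Prop. 19 (i)] -/
theorem serre_i_seven : IsSquare (((((7 : ℕ) : ℤ) + 1 - (5 : ℕ) : ℤ) : ZMod 5) ^ 2 - 4 * (7 : ℕ)) ∧ ((((7 : ℕ) : ℤ) + 1 - (5 : ℕ) : ℤ) : ZMod 5) ^ 2 - 4 * (7 : ℕ) ≠ 0 ∧ ((((7 : ℕ) : ℤ) + 1 - (5 : ℕ) : ℤ) : ZMod 5) ≠ 0 :=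
  ⟨⟨1, by decide⟩, by decide, by decide⟩

/-- Serre's condition (ii) at `ℓ₂ = 3` modulo `5` (`a = 3 + 1 − 7 = -3`): `a² − 4ℓ` is a non-square and `a ≢ 0`.
[cite: Serre1972, §2.8 Prop. 19 (ii)] -/
theorem serre_ii_three : ¬ IsSquare (((((3 : ℕ) : ℤ) + 1 - (7 : ℕ) : ℤ) : ZMod 5) ^ 2 - 4 * (3 : ℕ)) ∧ ((((3 : ℕ) : ℤ) + 1 - (7 : ℕ) : ℤ) : ZMod 5) ≠ 0 :=
  ⟨by decide, by decide⟩

/-- Serre's condition (iii) at `ℓ₃ = 3` modulo `5` (`a = 3 + 1 − 7 = -3`): `u = a²/ℓ ≡ 3`, `u ∉ {0, 1, 2, 4}`, `u² − 3u + 1 ≢ 0`.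
[cite: Serre1972, §2.8 Prop. 19 (iii)] -/
theorem serre_iii_three :
    ∃ u : ZMod 5, ((((3 : ℕ) : ℤ) + 1 - (7 : ℕ) : ℤ) : ZMod 5) ^ 2 = u * (3 : ℕ) ∧ u ≠ 0 ∧ u ≠ 1 ∧ u ≠ 2 ∧ u ≠ 4 ∧ u ^ 2 - 3 * u + 1 ≠ 0 :=
  ⟨3, by decide⟩

/-! ### The image at 5: surjective, irreducible; the class predicate reduces to the analytic rank -/

/-- **`ρ̄_{E,5}` is SURJECTIVE for `E` = 605a1** — Serre 1972 Prop. 19 with the Frobenius witnesses `ℓ₁ = 7`, `ℓ₂ = 3`, `ℓ₃ = 3`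
via the tree's `IntModel.hasSurjectiveModNGaloisRep_of_intModel_of_serreWitnesses` and the kernel point counts above (Cremona `galrep`: no
exceptional prime for 605a1). [cite: Serre1972, §2.8 Prop. 19 and §5.2 (iii)] [cite: Cremona1997, Table 1 (curve 605a1)] -/
theorem surj_five [Fact (Nat.Prime 5)] [((⟨1, -1, 0, -1414, -44027⟩ : WeierstrassCurve ℤ).baseChange ℚ).IsElliptic] [((⟨1, -1, 0, -1414, -44027⟩ : WeierstrassCurve ℤ).baseChange ℚ).IsGloballyMinimal] : Surj ((⟨1, -1, 0, -1414, -44027⟩ : WeierstrassCurve ℤ).baseChange ℚ) 5 := by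
  haveI : Fact (Nat.Prime 7) := ⟨by norm_num⟩
  haveI : Fact (Nat.Prime 3) := ⟨by norm_num⟩
  haveI : Fact (Nat.Prime 3) := ⟨by norm_num⟩
  exact IntModel.hasSurjectiveModNGaloisRep_of_intModel_of_serreWitnesses integralModelInt_eq 5 le_rfl 7 3 3
    (by norm_num) (by norm_num) (by norm_num)
    (by rw [Δ_eq]; norm_num) (by rw [Δ_eq]; norm_num) (by rw [Δ_eq]; norm_num)
    natCard_point_seven natCard_point_three natCard_point_three
    serre_i_seven serre_ii_three serre_iii_three

/-- **`E[5]` is IRREDUCIBLE for `E` = 605a1** (a surjective image is irreducible). [cite: Serre1972, §2.8 Prop. 19] -/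
theorem irr_five [Fact (Nat.Prime 5)] [((⟨1, -1, 0, -1414, -44027⟩ : WeierstrassCurve ℤ).baseChange ℚ).IsElliptic] [((⟨1, -1, 0, -1414, -44027⟩ : WeierstrassCurve ℤ).baseChange ℚ).IsGloballyMinimal] : Irr ((⟨1, -1, 0, -1414, -44027⟩ : WeierstrassCurve ℤ).baseChange ℚ) 5 :=
  irr_of_surj ((⟨1, -1, 0, -1414, -44027⟩ : WeierstrassCurve ℤ).baseChange ℚ) 5 surj_five

/-- **`ClassX11b E 5 ↔ r_an(E) = 1`** for `E` = 605a1: the conjuncts `5 ≠ 2`, `Mult E 5` (`mult_five`) and `Irr E 5` (`irr_five`) of the class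
predicate are kernel theorems, so membership in X11b at `5` is exactly the analytic-rank-one input (Cremona: `r = 1`; not certified here).
[cite: Cremona1997, Table 1 (curve 605a1)] -/
theorem classX11b_five_iff_analyticRank [Fact (Nat.Prime 5)] [((⟨1, -1, 0, -1414, -44027⟩ : WeierstrassCurve ℤ).baseChange ℚ).IsElliptic] [((⟨1, -1, 0, -1414, -44027⟩ : WeierstrassCurve ℤ).baseChange ℚ).IsGloballyMinimal] :
    ClassX11b ((⟨1, -1, 0, -1414, -44027⟩ : WeierstrassCurve ℤ).baseChange ℚ) 5 ↔ ((⟨1, -1, 0, -1414, -44027⟩ : WeierstrassCurve ℤ).baseChange ℚ).analyticRank = 1 :=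
  ⟨fun h ↦ h.1, fun h ↦ ⟨h, by decide, mult_five, irr_five⟩⟩

end Summit.BirchSwinnertonDyer.BirchSwinnertonDyer.Theorems.EulerHalfSplitTwinRoad.Rung605a1

end
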